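import Summits.QuantumFields.YangMills.Theorems.LuscherReductionRunningReductionAxialKernelFormula
import HarnessLib

/-!
# The temporal window of the axial kernel: restricting the tree-link (temporal) integral to `‖t_i − 1‖_F ≤ r` costs at most
# `(L³−1)·e^{2β|E|}·e^{−βr²/2}` (sub-stub I₁-a of the Born–Oppenheimer UPPER analysis — fixed-lattice programme COARSE(L₀); route `LuscherReduction`,
# crux RED stmt-QuantumFields-19978 KT-door 3b′ / crux `TwistedTraceScaling` stmt-QuantumFields-20203 S-BASE; design note
# `pub/ym-fleet/ym-luscher-20007-p1/COARSE-DESIGN.md` §10 I₁-a)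

Companion of `…AxialKernelFormula` (`axialKernel_eq`).  The temporal links `t_i` of the axial gauge carry the weights `w_β(t_i) = e^{β Re tr t_i} ≤ e^{2β}e^{−β‖t_i−1‖²_F/2}`,
so the `t`-integral concentrates on the window `{∀ i, ‖t_i − 1‖_F ≤ r}`, `r ≫ β^{−1/2}`:
* `axialIntegrand β w w' t` (the product of `…AxialKernelFormula`), measurable in `t`, `0 ≤ · ≤ e^{2β|E|}`, and `≤ e^{2β|E|} e^{−βr²/2}` as soon as ONE tree link is
  farther than `r` from `1` (`axialIntegrand_le_of_far`); `card_tree_add_card_off : |tree| + |off| = |E|`;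
* `treeWindow r`, `axialKernelWindow β r w w' = e^{−(β/2)(S+S')} ∫ 𝟙_{treeWindow r} · axialIntegrand`;
* ★ `axialKernelWindow_le` and `axialKernel_sub_window_le`:
  `0 ≤ axialKernel β w w' − axialKernelWindow β r w w' ≤ |tree| · e^{2β|E|} · e^{−βr²/2}` (union bound over the tree links).
With `r = β^{−1/2} log β` the defect is `e^{2β|E|} β^{−(log β)/2}`, negligible against `uniformFloorConst · c_β^{|E|} · λ_b` (cf. `crossBound_eventually_small`).
HONEST FRAMING: bookkeeping; femto rung R2b1; not infinite volume, not a gap, not Clay.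
-/

set_option autoImplicit false

noncomputable section

open MeasureTheory Filter Topology Real
open scoped Matrix ComplexConjugate BigOperators Matrix.Norms.Frobenius
open Literature.MathematicalPhysics.QuantumFieldTheory
open Literature.MathematicalPhysics.QuantumLattice

namespace Summit.QuantumFields.YangMills.Theorems.FemtoTransferGap

variable {L : ℕ} [NeZero L]

/-! ## §1 The integrand -/

/-- **The integrand of the axial kernel** (tree factors × non-tree factors). [folklore] -/
def axialIntegrand (β : ℝ) (w w' : OffIdx L → SU2) (t : TreeIdx L → SU2) : ℝ :=
  (∏ i : TreeIdx L, linkW β (t i)) *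
    ∏ i : OffIdx L, linkW β (w i * ((treeGauge (extOne t) i.1.1)⁻¹ * w' i * treeGauge (extOne t) (i.1.1.shift i.1.2))⁻¹)

/-- `axialKernel = e^{−(β/2)(S+S')} ∫ axialIntegrand`. [folklore] -/
theorem axialKernel_eq_integral (β : ℝ) (w w' : OffIdx L → SU2) :
    axialKernel β w w' = Real.exp (-(β / 2) * (wilsonAction su2Rep (glue w) + wilsonAction su2Rep (glue w'))) *
      ∫ t, axialIntegrand β w w' t ∂(Measure.pi fun _ : TreeIdx L => haarProbability SU2) :=
  axialKernel_eq β w w'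

/-- `0 < axialIntegrand`. [folklore] -/
theorem axialIntegrand_pos (β : ℝ) (w w' : OffIdx L → SU2) (t : TreeIdx L → SU2) : 0 < axialIntegrand β w w' t :=
  mul_pos (Finset.prod_pos fun _ _ => linkW_pos β _) (Finset.prod_pos fun _ _ => linkW_pos β _)

/-- `|tree| + |off| = |E|`. [folklore] -/
theorem card_tree_add_card_off : Fintype.card (TreeIdx L) + Fintype.card (OffIdx L) = Fintype.card (Edge 3 L) := by
  have h1 := Fintype.card_subtype_compl (fun e : Edge 3 L => treeEdge e = true)
  have h2 := Fintype.card_subtype_le (fun e : Edge 3 L => treeEdge e = true)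
  unfold TreeIdx OffIdx
  omega

/-- `axialIntegrand ≤ e^{2β|E|}` (`β ≥ 0`). [folklore] -/
theorem axialIntegrand_le {β : ℝ} (hβ : 0 ≤ β) (w w' : OffIdx L → SU2) (t : TreeIdx L → SU2) :
    axialIntegrand β w w' t ≤ Real.exp (2 * β) ^ Fintype.card (Edge 3 L) := by
  unfold axialIntegrand
  rw [← card_tree_add_card_off, pow_add]
  refine mul_le_mul ?_ ?_ (Finset.prod_nonneg fun _ _ => (linkW_pos β _).le) (by positivity)
  · rw [← Finset.card_univ, ← Finset.prod_const]
    exact Finset.prod_le_prod (fun _ _ => (linkW_pos β _).le) fun _ _ => linkW_le hβ _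
  · rw [← Finset.card_univ, ← Finset.prod_const]
    exact Finset.prod_le_prod (fun _ _ => (linkW_pos β _).le) fun _ _ => linkW_le hβ _

/-- One link far from `1` costs `e^{−βr²/2}`: `r < ‖W − 1‖_F ⇒ w_β(W) ≤ e^{2β} e^{−βr²/2}` (`β, r ≥ 0`). [folklore] -/
theorem linkW_le_of_far {β : ℝ} (hβ : 0 ≤ β) {r : ℝ} (hr : 0 ≤ r) {W : SU2} (hW : r < frobNorm ((W : Matrix (Fin 2) (Fin 2) ℂ) - 1)) :
    linkW β W ≤ Real.exp (2 * β) * Real.exp (-(β * r ^ 2 / 2)) := by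
  unfold linkW
  rw [← Real.exp_add]
  refine Real.exp_le_exp.2 ?_
  have htr := two_sub_re_trace_eq W
  have hsq : r ^ 2 ≤ frobNorm ((W : Matrix (Fin 2) (Fin 2) ℂ) - 1) ^ 2 := pow_le_pow_left₀ hr hW.le 2
  nlinarith

/-- ★ If some tree link is farther than `r` from `1`, the integrand is `≤ e^{2β|E|} e^{−βr²/2}` (`β, r ≥ 0`). [folklore] -/
theorem axialIntegrand_le_of_far {β : ℝ} (hβ : 0 ≤ β) {r : ℝ} (hr : 0 ≤ r) (w w' : OffIdx L → SU2) {t : TreeIdx L → SU2} {j : TreeIdx L}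
    (hj : r < frobNorm ((t j : Matrix (Fin 2) (Fin 2) ℂ) - 1)) :
    axialIntegrand β w w' t ≤ Real.exp (2 * β) ^ Fintype.card (Edge 3 L) * Real.exp (-(β * r ^ 2 / 2)) := by
  unfold axialIntegrand
  have htree : ∏ i : TreeIdx L, linkW β (t i) ≤ Real.exp (2 * β) ^ Fintype.card (TreeIdx L) * Real.exp (-(β * r ^ 2 / 2)) := by
    rw [← Finset.mul_prod_erase Finset.univ _ (Finset.mem_univ j)]
    have hcard : 1 ≤ Fintype.card (TreeIdx L) := Fintype.card_pos_iff.mpr ⟨j⟩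
    obtain ⟨n, hn⟩ : ∃ n : ℕ, Fintype.card (TreeIdx L) = n + 1 := ⟨Fintype.card (TreeIdx L) - 1, by omega⟩
    have hrest : ∏ i ∈ Finset.univ.erase j, linkW β (t i) ≤ Real.exp (2 * β) ^ n := by
      have hc : (Finset.univ.erase j).card = n := by rw [Finset.card_erase_of_mem (Finset.mem_univ j), Finset.card_univ]; omega
      rw [← hc, ← Finset.prod_const]
      exact Finset.prod_le_prod (fun _ _ => (linkW_pos β _).le) fun _ _ => linkW_le hβ _
    calc linkW β (t j) * ∏ i ∈ Finset.univ.erase j, linkW β (t i)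
        ≤ (Real.exp (2 * β) * Real.exp (-(β * r ^ 2 / 2))) * Real.exp (2 * β) ^ n :=
          mul_le_mul (linkW_le_of_far hβ hr hj) hrest (Finset.prod_nonneg fun _ _ => (linkW_pos β _).le) (by positivity)
      _ = Real.exp (2 * β) ^ Fintype.card (TreeIdx L) * Real.exp (-(β * r ^ 2 / 2)) := by rw [hn, pow_succ]; ring
  have hoff : ∏ i : OffIdx L, linkW β (w i * ((treeGauge (extOne t) i.1.1)⁻¹ * w' i * treeGauge (extOne t) (i.1.1.shift i.1.2))⁻¹) ≤
      Real.exp (2 * β) ^ Fintype.card (OffIdx L) := by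
    rw [← Finset.card_univ, ← Finset.prod_const]
    exact Finset.prod_le_prod (fun _ _ => (linkW_pos β _).le) fun _ _ => linkW_le hβ _
  calc _ ≤ (Real.exp (2 * β) ^ Fintype.card (TreeIdx L) * Real.exp (-(β * r ^ 2 / 2))) * Real.exp (2 * β) ^ Fintype.card (OffIdx L) :=
        mul_le_mul htree hoff (Finset.prod_nonneg fun _ _ => (linkW_pos β _).le) (by positivity)
    _ = Real.exp (2 * β) ^ Fintype.card (Edge 3 L) * Real.exp (-(β * r ^ 2 / 2)) := by
        rw [← card_tree_add_card_off, pow_add]; ring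

/-- The integrand is measurable in the tree data. [folklore] -/
theorem measurable_axialIntegrand (β : ℝ) (w w' : OffIdx L → SU2) : Measurable (axialIntegrand (L := L) β w w') := by
  haveI : SecondCountableTopology SU2 := secondCountableTopology_su2
  have hA : ∀ x : Site 3 L, Measurable fun t : TreeIdx L → SU2 => treeGauge (extOne t) x := fun x =>
    (continuous_treeGauge x).measurable.comp measurable_extOne
  unfold axialIntegrand
  refine Measurable.mul (Finset.measurable_prod _ fun i _ => (measurable_linkW β).comp (measurable_pi_apply i))
    (Finset.measurable_prod _ fun i _ => (measurable_linkW β).comp ?_)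
  exact measurable_const.mul (((hA _).inv.mul measurable_const).mul (hA _)).inv

/-! ## §2 The temporal window -/

/-- **Temporal window** `{t | ∀ i, ‖t_i − 1‖_F ≤ r}`. [folklore] -/
def treeWindow (r : ℝ) : Set (TreeIdx L → SU2) := {t | ∀ i, frobNorm ((t i : Matrix (Fin 2) (Fin 2) ℂ) - 1) ≤ r}

/-- The window is measurable. [folklore] -/
theorem measurableSet_treeWindow (r : ℝ) : MeasurableSet (treeWindow (L := L) r) := by
  have h : treeWindow (L := L) r = Set.pi Set.univ fun _ : TreeIdx L => {W : SU2 | frobNorm ((W : Matrix (Fin 2) (Fin 2) ℂ) - 1) ≤ r} := by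
    ext t; simp [treeWindow]
  rw [h]
  exact MeasurableSet.univ_pi fun _ => measurableSet_frobBall_one r

/-- **Windowed axial kernel**: the temporal integral restricted to the window. [folklore] -/
def axialKernelWindow (β r : ℝ) (w w' : OffIdx L → SU2) : ℝ :=
  Real.exp (-(β / 2) * (wilsonAction su2Rep (glue w) + wilsonAction su2Rep (glue w'))) *
    ∫ t, (treeWindow r).indicator (axialIntegrand β w w') t ∂(Measure.pi fun _ : TreeIdx L => haarProbability SU2)

/-- The integrand is integrable (`β ≥ 0`). [folklore] -/
theorem integrable_axialIntegrand {β : ℝ} (hβ : 0 ≤ β) (w w' : OffIdx L → SU2) :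
    Integrable (axialIntegrand β w w') (Measure.pi fun _ : TreeIdx L => haarProbability SU2) :=
  Integrable.of_bound (measurable_axialIntegrand β w w').aestronglyMeasurable (Real.exp (2 * β) ^ Fintype.card (Edge 3 L))
    (ae_of_all _ fun t => by
      rw [Real.norm_eq_abs, abs_of_pos (axialIntegrand_pos β w w' t)]; exact axialIntegrand_le hβ w w' t)

/-- The magnetic prefactor is `≤ 1`. [folklore] -/
theorem magneticPrefactor_le_one {β : ℝ} (hβ : 0 ≤ β) (w w' : OffIdx L → SU2) :
    Real.exp (-(β / 2) * (wilsonAction su2Rep (glue w) + wilsonAction su2Rep (glue w'))) ≤ 1 := by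
  refine Real.exp_le_one_iff.mpr ?_
  have h1 := wilsonAction_su2_nonneg_lat (glue w)
  have h2 := wilsonAction_su2_nonneg_lat (glue w')
  nlinarith

/-- ★ `axialKernelWindow ≤ axialKernel` (`β ≥ 0`). [folklore] -/
theorem axialKernelWindow_le {β : ℝ} (hβ : 0 ≤ β) (r : ℝ) (w w' : OffIdx L → SU2) : axialKernelWindow β r w w' ≤ axialKernel β w w' := by
  rw [axialKernel_eq_integral]
  unfold axialKernelWindow
  refine mul_le_mul_of_nonneg_left ?_ (Real.exp_pos _).le
  refine integral_mono ((integrable_axialIntegrand hβ w w').indicator (measurableSet_treeWindow r)) (integrable_axialIntegrand hβ w w') fun t => ?_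
  exact Set.indicator_le_self' (fun _ _ => (axialIntegrand_pos β w w' _).le) t

/-- ★★ **Temporal window defect**: `axialKernel − axialKernelWindow r ≤ |tree| · e^{2β|E|} · e^{−βr²/2}` (`β, r ≥ 0`; union bound over the tree links,
`axialIntegrand_le_of_far`). [folklore] -/
theorem axialKernel_sub_window_le {β : ℝ} (hβ : 0 ≤ β) {r : ℝ} (hr : 0 ≤ r) (w w' : OffIdx L → SU2) :
    axialKernel β w w' - axialKernelWindow β r w w' ≤
      Fintype.card (TreeIdx L) * (Real.exp (2 * β) ^ Fintype.card (Edge 3 L) * Real.exp (-(β * r ^ 2 / 2))) := by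
  set B : ℝ := Real.exp (2 * β) ^ Fintype.card (Edge 3 L) * Real.exp (-(β * r ^ 2 / 2)) with hB
  have hB0 : 0 ≤ B := by positivity
  set μT : Measure (TreeIdx L → SU2) := Measure.pi fun _ : TreeIdx L => haarProbability SU2 with hμT
  -- the defect of the `t`-integral
  have hint := integrable_axialIntegrand (L := L) hβ w w'
  have hintw := hint.indicator (measurableSet_treeWindow (L := L) r)
  have hbad : ∀ j : TreeIdx L, MeasurableSet {t : TreeIdx L → SU2 | r < frobNorm ((t j : Matrix (Fin 2) (Fin 2) ℂ) - 1)} := fun j =>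
    measurableSet_lt measurable_const ((continuous_frobNorm'.comp (continuous_subtype_val.sub continuous_const)).measurable.comp (measurable_pi_apply j))
  have hpt : ∀ t : TreeIdx L → SU2, axialIntegrand β w w' t - (treeWindow r).indicator (axialIntegrand β w w') t ≤
      ∑ j : TreeIdx L, ({t : TreeIdx L → SU2 | r < frobNorm ((t j : Matrix (Fin 2) (Fin 2) ℂ) - 1)}).indicator (fun _ => B) t := by
    intro t
    by_cases ht : t ∈ treeWindow r
    · rw [Set.indicator_of_mem ht, sub_self]
      exact Finset.sum_nonneg fun j _ => Set.indicator_nonneg (fun _ _ => hB0) _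
    · rw [Set.indicator_of_notMem ht, sub_zero]
      obtain ⟨j, hj⟩ : ∃ j, r < frobNorm ((t j : Matrix (Fin 2) (Fin 2) ℂ) - 1) := by
        by_contra h; push Not at h; exact ht h
      refine (axialIntegrand_le_of_far hβ hr w w' hj).trans ?_
      rw [← hB]
      refine le_trans (le_of_eq (Set.indicator_of_mem (show t ∈ {t : TreeIdx L → SU2 | r < frobNorm ((t j : Matrix (Fin 2) (Fin 2) ℂ) - 1)} from hj)
        (fun _ => B)).symm) ?_
      exact Finset.single_le_sum (f := fun j' => ({t : TreeIdx L → SU2 | r < frobNorm ((t j' : Matrix (Fin 2) (Fin 2) ℂ) - 1)}).indicator (fun _ => B) t)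
        (fun j' _ => Set.indicator_nonneg (fun _ _ => hB0) _) (Finset.mem_univ j)
  have hsumint : Integrable (fun t : TreeIdx L → SU2 => ∑ j : TreeIdx L,
      ({t : TreeIdx L → SU2 | r < frobNorm ((t j : Matrix (Fin 2) (Fin 2) ℂ) - 1)}).indicator (fun _ => B) t) μT :=
    integrable_finsetSum _ fun j _ => (integrable_const B).indicator (hbad j)
  have hdef : ∫ t, axialIntegrand β w w' t ∂μT - ∫ t, (treeWindow r).indicator (axialIntegrand β w w') t ∂μT ≤ Fintype.card (TreeIdx L) * B := by
    rw [← integral_sub hint hintw]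
    refine (integral_mono (hint.sub hintw) hsumint hpt).trans ?_
    rw [integral_finsetSum _ fun j _ => (integrable_const B).indicator (hbad j)]
    calc ∑ j : TreeIdx L, ∫ t, ({t : TreeIdx L → SU2 | r < frobNorm ((t j : Matrix (Fin 2) (Fin 2) ℂ) - 1)}).indicator (fun _ => B) t ∂μT
        ≤ ∑ _j : TreeIdx L, B := Finset.sum_le_sum fun j _ => by
          rw [integral_indicator_const _ (hbad j), smul_eq_mul]
          exact mul_le_of_le_one_left hB0 measureReal_le_one
      _ = Fintype.card (TreeIdx L) * B := by rw [Finset.sum_const, Finset.card_univ, nsmul_eq_mul]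
  -- assemble with the magnetic prefactor `≤ 1`
  rw [axialKernel_eq_integral]
  unfold axialKernelWindow
  rw [← mul_sub]
  have hpre := magneticPrefactor_le_one hβ w w'
  have hdef0 : 0 ≤ ∫ t, axialIntegrand β w w' t ∂μT - ∫ t, (treeWindow r).indicator (axialIntegrand β w w') t ∂μT := by
    rw [sub_nonneg]
    exact integral_mono hintw hint fun t => Set.indicator_le_self' (fun _ _ => (axialIntegrand_pos β w w' _).le) t
  calc Real.exp (-(β / 2) * (wilsonAction su2Rep (glue w) + wilsonAction su2Rep (glue w'))) *
        (∫ t, axialIntegrand β w w' t ∂μT - ∫ t, (treeWindow r).indicator (axialIntegrand β w w') t ∂μT)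
      ≤ 1 * (∫ t, axialIntegrand β w w' t ∂μT - ∫ t, (treeWindow r).indicator (axialIntegrand β w w') t ∂μT) :=
        mul_le_mul_of_nonneg_right hpre hdef0
    _ ≤ Fintype.card (TreeIdx L) * B := by rw [one_mul]; exact hdef

end Summit.QuantumFields.YangMills.Theorems.FemtoTransferGap

end
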